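import Summits.Ventures.LatticeQCDFlow.Scaling.HubChainTransitionLaw

/-!
HONEST FRAMING: exact (Metropolis-corrected) sampling algorithms for lattice gauge theory; figures
of merit are autocorrelation/cost numbers at stated couplings and volumes; no continuum-physics
claim.

# HubChainPersistenceForm — THE SWAP PHASE SOLVED EXACTLY, IX: THE SMITH–TIERNEY FUNCTION IN PERSISTENCE FORM, `T_n(j) = c·Σ_{j<k<m}(W_{k−1} − W_k)·H_n(β_k, β_{k−1}) + c·W_{m−1}·H_n(1, β_{m−1})`
# (`W = 1/ρ`, `H_n(x,y) = Σ_{t<n}xᵗyⁿ⁻¹⁻ᵗ`): THE RANK MASSES `R_k` DROP OUT, SINCE `β_k − β_{k−1} = c·R_k·(W_{k−1} − W_k)` EXACTLY (lean-2 GEN-39, ours)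

Venture-side (OURS).  Cell `lqcd-flow` (pub-lqcd), unit `pub-lqcd-lean-2-g39`, 2026-08-30.  Chapter Y, file 9.  Setting of files 1–2.  The `n`-step law of the hub chain seen from the target is
`Pⁿ(i,j) = ρ_jT_n(max(i,j)) + β_iⁿδ_{ij}` with `T_n(j) = (1−β_jⁿ)/R_m + Σ_{k>j}(1/R_k − 1/R_{k+1})(β_kⁿ − β_jⁿ)` (file 2).  Two exact identities reorganise it:

* `hubChain_abel_rank` (Abel summation over the ranks): `(1−β_jⁿ)/R_m + Σ_{j<k<m}(1/R_k − 1/R_{k+1})(β_kⁿ − β_jⁿ) = Σ_{j<k<m}(β_kⁿ − β_{k−1}ⁿ)/R_k + (1 − β_{m−1}ⁿ)/R_m`;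
* `hubChain_beta_step`: **`β_k − β_{k−1} = c·R_k·(1/ρ_{k−1} − 1/ρ_k)`** for `1 ≤ k < m`, and `1 − β_{m−1} = c·R_m/ρ_{m−1}`;
* hence, with `H_n(x,y) = Σ_{t<n}xᵗyⁿ⁻¹⁻ᵗ` (`(x−y)H_n(x,y) = xⁿ − yⁿ`), **`hubChain_T_persistence`**:
  `T_n(j) = c·Σ_{j<k<m}(1/ρ_{k−1} − 1/ρ_k)·H_n(β_k,β_{k−1}) + (c/ρ_{m−1})·H_n(1,β_{m−1})` — a PERSISTENCE-WEIGHTED sum of complete homogeneous polynomials of consecutive eigenvalues,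
  with non-negative weights `W_{k−1} − W_k` and `W_{m−1}`, and NO `R`'s;
* `hubChain_H_nonneg`, `hubChain_H_mono` (`H_n` is non-negative and non-decreasing in each argument on `[0,∞)²`).

Reading (no numerics implied): in this form the dependence of the `j`-attempt laws on the depth of ONE particle `s` is transparent whenever the target is deeper than `s`: the weights at
ranks `> s` do not see `ρ_s`, and every `β_k` (`k > s`) decreases linearly in `ρ_s` at rate `c/ρ_k` — file 10 turns this into per-step domination at deep targets.  Literature grade (cell
rule): OWN, elementary; nothing cited; no new bib keys.
-/

open Finset

namespace Summit.Ventures.LatticeQCDFlow.Scaling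

section PersistenceForm
variable {m : ℕ} {ρ R β : ℕ → ℝ} {c : ℝ} {T : ℕ → ℕ → ℝ} {H : ℕ → ℝ → ℝ → ℝ}

/-- **Abel summation over the ranks** (pure algebra): for any `A, b : ℕ → ℝ`, any `cc`, and `m = j+1+d`,
`(cc − b_j)A_m + Σ_{k∈[j+1,m)}(A_k − A_{k+1})(b_k − b_j) = Σ_{k∈[j+1,m)}A_k(b_k − b_{k−1}) + A_m(cc − b_{m−1})`. [ours] -/
theorem hubChain_abel_rank (A b : ℕ → ℝ) (j : ℕ) : ∀ (d : ℕ) (cc : ℝ),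
    (cc - b j) * A (j + 1 + d) + ∑ k ∈ Ico (j + 1) (j + 1 + d), (A k - A (k + 1)) * (b k - b j)
      = (∑ k ∈ Ico (j + 1) (j + 1 + d), A k * (b k - b (k - 1))) + A (j + 1 + d) * (cc - b (j + 1 + d - 1)) := by
  intro d
  induction d with
  | zero => intro cc; simp; ring
  | succ d ih =>
      intro cc
      rw [show j + 1 + (d + 1) = j + 1 + d + 1 by omega, Finset.sum_Ico_succ_top (by omega : j + 1 ≤ j + 1 + d),
        Finset.sum_Ico_succ_top (by omega : j + 1 ≤ j + 1 + d), show j + 1 + d + 1 - 1 = j + 1 + d by omega]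
      have h := ih (b (j + 1 + d))
      rw [show j + 1 + d - 1 = j + d by omega] at h ⊢
      -- `h`: `(b_{m} − b_j)A_m + S = S' + A_m(b_m − b_{m−1})` with `m = j+1+d`
      linear_combination h

/-- **The eigenvalue step:** `β_k − β_{k−1} = c·R_k·(1/ρ_{k−1} − 1/ρ_k)` for `1 ≤ k < m`. [ours] -/
theorem hubChain_beta_step (hρ : ∀ i, 0 < ρ i) (hR : ∀ k, R k = ∑ i ∈ range k, ρ i)
    (hβ : ∀ k, β k = 1 - c * (((m - k : ℕ) : ℝ) + R k / ρ k)) {k : ℕ} (hk1 : 1 ≤ k) (hk : k < m) :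
    β k - β (k - 1) = c * R k * (1 / ρ (k - 1) - 1 / ρ k) := by
  have hRk : R k = R (k - 1) + ρ (k - 1) := by
    rw [hR k, hR (k - 1), show k = (k - 1) + 1 from by omega, sum_range_succ, Nat.add_sub_cancel]
  rw [hβ k, hβ (k - 1), hRk]
  have e : (((m - (k - 1) : ℕ) : ℝ)) = ((m - k : ℕ) : ℝ) + 1 := by
    rw [show m - (k - 1) = (m - k) + 1 by omega]; push_cast; ring
  rw [e]
  have h1 := (hρ k).ne'; have h2 := (hρ (k - 1)).ne'
  field_simp
  ring

/-- The top step: `1 − β_{m−1} = c·R_m/ρ_{m−1}` (`m ≥ 1`). [ours] -/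
theorem hubChain_beta_top (hR : ∀ k, R k = ∑ i ∈ range k, ρ i)
    (hβ : ∀ k, β k = 1 - c * (((m - k : ℕ) : ℝ) + R k / ρ k)) (hρm : ρ (m - 1) ≠ 0) (hm : 1 ≤ m) :
    1 - β (m - 1) = c * R m / ρ (m - 1) := by
  have hRm : R m = R (m - 1) + ρ (m - 1) := by
    rw [hR m, hR (m - 1), show m = (m - 1) + 1 from by omega, sum_range_succ, Nat.add_sub_cancel]
  rw [hβ (m - 1), show m - (m - 1) = 1 by omega, hRm]
  push_cast
  field_simp
  ring

/-- `H_n(x,y)·(x − y) = xⁿ − yⁿ` for `H_n(x,y) = Σ_{t<n}xᵗyⁿ⁻¹⁻ᵗ` (Mathlib's `geom_sum₂_mul`). [ours] -/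
theorem hubChain_H_mul (hH : ∀ n x y, H n x y = ∑ t ∈ range n, x ^ t * y ^ (n - 1 - t)) (n : ℕ) (x y : ℝ) : H n x y * (x - y) = x ^ n - y ^ n := by
  rw [hH]; exact geom_sum₂_mul x y n

/-- `H_n ≥ 0` on `[0,∞)²`. [ours] -/
theorem hubChain_H_nonneg (hH : ∀ n x y, H n x y = ∑ t ∈ range n, x ^ t * y ^ (n - 1 - t)) (n : ℕ) {x y : ℝ} (hx : 0 ≤ x) (hy : 0 ≤ y) : 0 ≤ H n x y := by
  rw [hH]; exact sum_nonneg fun t _ => mul_nonneg (pow_nonneg hx t) (pow_nonneg hy _)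

/-- `H_n` is non-decreasing in each argument on `[0,∞)²`. [ours] -/
theorem hubChain_H_mono (hH : ∀ n x y, H n x y = ∑ t ∈ range n, x ^ t * y ^ (n - 1 - t)) (n : ℕ) {x y x' y' : ℝ} (hx : 0 ≤ x) (hy : 0 ≤ y)
    (hxx : x ≤ x') (hyy : y ≤ y') : H n x y ≤ H n x' y' := by
  rw [hH, hH]
  exact sum_le_sum fun t _ => mul_le_mul (pow_le_pow_left₀ hx hxx t) (pow_le_pow_left₀ hy hyy _) (pow_nonneg hy _) (pow_nonneg (hx.trans hxx) t)

/-- **THE PERSISTENCE FORM OF `T_n`:** for `j < m`,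
`T_n(j) = c·Σ_{j<k<m}(1/ρ_{k−1} − 1/ρ_k)·H_n(β_k,β_{k−1}) + (c/ρ_{m−1})·H_n(1,β_{m−1})`. [ours] -/
theorem hubChain_T_persistence (hρ : ∀ i, 0 < ρ i) (hR : ∀ k, R k = ∑ i ∈ range k, ρ i)
    (hβ : ∀ k, β k = 1 - c * (((m - k : ℕ) : ℝ) + R k / ρ k))
    (hT : ∀ n j, T n j = (1 - β j ^ n) / R m + ∑ k ∈ Ico (j + 1) m, (1 / R k - 1 / R (k + 1)) * (β k ^ n - β j ^ n))
    (hH : ∀ n x y, H n x y = ∑ t ∈ range n, x ^ t * y ^ (n - 1 - t)) (n : ℕ) {j : ℕ} (hj : j < m) :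
    T n j = c * (∑ k ∈ Ico (j + 1) m, (1 / ρ (k - 1) - 1 / ρ k) * H n (β k) (β (k - 1))) + c / ρ (m - 1) * H n 1 (β (m - 1)) := by
  obtain ⟨d, hd⟩ : ∃ d, m = j + 1 + d := ⟨m - (j + 1), by omega⟩
  -- Abel summation with `A_k = 1/R_k`, `b_k = β_kⁿ`, `cc = 1`
  have habel := hubChain_abel_rank (fun k => 1 / R k) (fun k => β k ^ n) j d 1
  rw [← hd] at habel
  have hT' : T n j = (∑ k ∈ Ico (j + 1) m, 1 / R k * (β k ^ n - β (k - 1) ^ n)) + 1 / R m * (1 - β (m - 1) ^ n) := by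
    rw [hT, ← habel]; ring
  rw [hT', mul_sum]
  have hRpos : ∀ k, 1 ≤ k → 0 < R k := fun k hk => by rw [hR k]; exact sum_pos (fun i _ => hρ i) ⟨0, mem_range.mpr (by omega)⟩
  congr 1
  · refine sum_congr rfl fun k hk => ?_
    have hk' : j + 1 ≤ k ∧ k < m := by simpa using mem_Ico.mp hk
    have hstep := hubChain_beta_step hρ hR hβ (by omega : 1 ≤ k) hk'.2
    have hmul := hubChain_H_mul hH n (β k) (β (k - 1))
    have hRk := (hRpos k (by omega)).ne'
    -- `(β_kⁿ − β_{k−1}ⁿ)/R_k = H·(β_k − β_{k−1})/R_k = c·(1/ρ_{k−1} − 1/ρ_k)·H`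
    rw [← hmul, hstep]
    field_simp
  · have hmul := hubChain_H_mul hH n 1 (β (m - 1))
    have htop := hubChain_beta_top hR hβ (hρ (m - 1)).ne' (by omega : 1 ≤ m)
    have hRm := (hRpos m (by omega)).ne'
    have hρm := (hρ (m - 1)).ne'
    rw [one_pow] at hmul
    rw [← hmul, htop]
    field_simp

end PersistenceForm

end Summit.Ventures.LatticeQCDFlow.Scaling
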